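import Summits.CriticalPhenomena.SAWScalingLimit.Theorems.SAWLoopFugacityFlowIsingBoundaryRatioHalfAnnulusRimCrossingBoundLargeOf
import Literature.Probability.LatticeModels.DiscreteExtremalLengthExternalArcsProofs
import Literature.Analysis.Complex.ExtremalLength
import HarnessLib

/-!
# Resistance bound for the window rectangle — the block metric and its area
(line `fk-anchor-transfer`, crux `IsingBoundaryRatio`, stmt-CriticalPhenomena-10650; helper module of the proof of
`WindowExtResistanceBound`, `…IsingBoundaryRatioWindowResistanceDefs.lean`)

The continuous side of Chelkak's length comparison (D. Chelkak, *Robust discrete complex analysis: a toolbox*,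
Ann. Probab. 44 (2016), proof of Prop. 6.2 (i): "for a given discrete metric `g` … set
`ĝ(z) = Σ_{(xy): z ∈ S_{(xy)}} g_{(xy)}`, `S_{(xy)}` a block of faces … `Area(ĝ) ≤ const · A_g`"). For an
edge metric `W : Sym2 (Site 2 ⊕ Site 2 × Fin 4) → ℝ≥0` on the completed graph `Ω̄ = DiscreteRect.extGraph E` of
a finite set `E` of lattice edges at mesh `δ`, the Borel metric used by the proof is
`ĝ(z) = Σ_{x ∈ verts E} w(x) · 𝟙[dist(z, δx) ≤ 6δ]`, `w(x) = Σ_{e ∋ inl x} W(e)` (sum over a finite set `F` of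
edges of `Ω̄`); it is written inline (no definition is introduced).

* `wer_lintegral_sq_le` — `∬ ĝ² ≤ 4·10⁵ δ² Σ_{e ∈ F} W(e)²`: at most `169` of the balls contain a given point
  (`wer_card_near`), at most `8` edges of `Ω̄` contain a lattice vertex (`wer_card_edges_at`, with
  `exists_dir_of_zdGraph_adj_rim` of `…HalfAnnulusRimCrossingBoundLargeOf.lean`), at most `2`
  lattice vertices lie on an edge (`wer_card_inl_mem`), Cauchy–Schwarz twice and `|B(6δ)| = 36πδ²`;
* `wer_sum_sq_le_networkArea` — `Σ_{e ∈ F} W(e)² ≤ networkArea Ω̄ 1 W` for `F ⊆ E(Ω̄)`;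
* `wer_exists_edgeFinset` — the edge set of `Ω̄` as a `Finset`.

All statements are folklore.
-/

noncomputable section

open scoped Classical Topology ENNReal NNReal
open Filter Set Metric SimpleGraph MeasureTheory
open Literature.Probability.LatticeModels Literature.Probability.RandomPlanarGeometry
open Literature.Probability.Percolation (BondConfig)
open UpperHalfPlane (upperHalfPlaneSet)

namespace Summit.CriticalPhenomena.SAWScalingLimit.Theorems.IsingBoundaryRatio

/-- At most eight edges of the completed graph `Ω̄` contain a given lattice vertex (four lattice edges,
four pendant edges). [folklore] -/
theorem wer_card_edges_at {E : Finset (Sym2 (Site 2))} (hEz : ∀ e ∈ E, e ∈ (zdGraph 2).edgeSet) (x : Site 2)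
    {F : Finset (Sym2 (Site 2 ⊕ Site 2 × Fin 4))} (hF : ∀ e ∈ F, e ∈ (DiscreteRect.extGraph E).edgeSet) :
    (F.filter (fun e => Sum.inl x ∈ e)).card ≤ 8 := by
  set f : Fin 4 × Bool → Sym2 (Site 2 ⊕ Site 2 × Fin 4) := fun kb =>
    if kb.2 then s(Sum.inl x, Sum.inl (x + DiscreteRect.dir kb.1)) else s(Sum.inl x, Sum.inr (x, kb.1)) with hf
  have hsub : F.filter (fun e => Sum.inl x ∈ e) ⊆ Finset.univ.image f := by
    intro e he
    rw [Finset.mem_filter] at he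
    obtain ⟨heF, hxe⟩ := he
    obtain ⟨v, rfl⟩ := Sym2.mem_iff_exists.1 hxe
    have hadj : (DiscreteRect.extGraph E).Adj (Sum.inl x) v := hF _ heF
    rw [Finset.mem_image]
    cases v with
    | inl y =>
      obtain ⟨-, hxy⟩ := DiscreteRect.extGraph_adj_inl_inl.1 hadj
      have hzd : (zdGraph 2).Adj x y := (SimpleGraph.mem_edgeSet _).1 (hEz _ hxy)
      obtain ⟨k, rfl⟩ := exists_dir_of_zdGraph_adj_rim hzd
      exact ⟨(k, true), Finset.mem_univ _, by simp [hf]⟩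
    | inr d =>
      obtain ⟨-, hd1⟩ := DiscreteRect.extGraph_adj_inl_inr.1 hadj
      refine ⟨(d.2, false), Finset.mem_univ _, ?_⟩
      obtain ⟨d1, d2⟩ := d
      simp only at hd1
      subst hd1
      simp [hf]
  calc (F.filter (fun e => Sum.inl x ∈ e)).card ≤ (Finset.univ.image f).card := Finset.card_le_card hsub
    _ ≤ (Finset.univ : Finset (Fin 4 × Bool)).card := Finset.card_image_le
    _ = 8 := by simp

/-- At most two lattice vertices lie on an unordered pair of vertices of `Ω̄`. [folklore] -/
theorem wer_card_inl_mem (S : Finset (Site 2)) (e : Sym2 (Site 2 ⊕ Site 2 × Fin 4)) :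
    (S.filter (fun x => Sum.inl x ∈ e)).card ≤ 2 := by
  induction e using Sym2.ind with
  | h u v =>
    have hsub : S.filter (fun x => Sum.inl x ∈ s(u, v)) ⊆ ([u, v].filterMap Sum.getLeft?).toFinset := by
      intro x hx
      rw [Finset.mem_filter] at hx
      rw [List.mem_toFinset, List.mem_filterMap]
      rcases Sym2.mem_iff.1 hx.2 with h | h
      · exact ⟨u, by simp, by rw [← h]; rfl⟩
      · exact ⟨v, by simp, by rw [← h]; rfl⟩
    calc (S.filter (fun x => Sum.inl x ∈ s(u, v))).card ≤ ([u, v].filterMap Sum.getLeft?).toFinset.card :=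
          Finset.card_le_card hsub
      _ ≤ ([u, v].filterMap Sum.getLeft?).length := List.toFinset_card_le _
      _ ≤ [u, v].length := List.length_filterMap_le _ _
      _ = 2 := rfl

/-- At most `169` lattice sites have mesh point within `6δ` of a given point. [folklore] -/
theorem wer_card_near {δ : ℝ} (hδ : 0 < δ) (z : ℂ) (S : Finset (Site 2)) :
    (S.filter (fun x => dist z (meshPoint δ x) ≤ 6 * δ)).card ≤ 169 := by
  set a : ℤ := ⌊z.re / δ⌋ with ha
  set b : ℤ := ⌊z.im / δ⌋ with hb
  have hsub : S.filter (fun x => dist z (meshPoint δ x) ≤ 6 * δ) ⊆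
      ((Finset.Icc (a - 6) (a + 6)) ×ˢ (Finset.Icc (b - 6) (b + 6))).image (fun p => ![p.1, p.2]) := by
    intro x hx
    rw [Finset.mem_filter] at hx
    obtain ⟨-, hd⟩ := hx
    rw [Complex.dist_eq] at hd
    have hre := (Complex.abs_re_le_norm (z - meshPoint δ x)).trans hd
    have him := (Complex.abs_im_le_norm (z - meshPoint δ x)).trans hd
    rw [Complex.sub_re, meshPoint_re, abs_le] at hre
    rw [Complex.sub_im, meshPoint_im, abs_le] at him
    have h1 := Int.floor_le (z.re / δ)
    have h2 := Int.lt_floor_add_one (z.re / δ)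
    have h3 := Int.floor_le (z.im / δ)
    have h4 := Int.lt_floor_add_one (z.im / δ)
    rw [← ha, le_div_iff₀ hδ] at h1
    rw [← ha, div_lt_iff₀ hδ] at h2
    rw [← hb, le_div_iff₀ hδ] at h3
    rw [← hb, div_lt_iff₀ hδ] at h4
    have e1 : ((a - 6 : ℤ) : ℝ) - 1 < (x 0 : ℝ) := by push_cast; nlinarith
    have e2 : (x 0 : ℝ) < (a + 6 : ℤ) + 1 := by push_cast; nlinarith
    have e3 : ((b - 6 : ℤ) : ℝ) - 1 < (x 1 : ℝ) := by push_cast; nlinarith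
    have e4 : (x 1 : ℝ) < (b + 6 : ℤ) + 1 := by push_cast; nlinarith
    have f1 : a - 6 ≤ x 0 := by
      have : ((a - 6 : ℤ) : ℝ) < (x 0 : ℝ) + 1 := by linarith
      exact Int.lt_add_one_iff.1 (by exact_mod_cast this)
    have f2 : x 0 ≤ a + 6 := Int.lt_add_one_iff.1 (by exact_mod_cast e2)
    have f3 : b - 6 ≤ x 1 := by
      have : ((b - 6 : ℤ) : ℝ) < (x 1 : ℝ) + 1 := by linarith
      exact Int.lt_add_one_iff.1 (by exact_mod_cast this)
    have f4 : x 1 ≤ b + 6 := Int.lt_add_one_iff.1 (by exact_mod_cast e4)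
    rw [Finset.mem_image]
    refine ⟨(x 0, x 1), Finset.mem_product.2 ⟨Finset.mem_Icc.2 ⟨f1, f2⟩, Finset.mem_Icc.2 ⟨f3, f4⟩⟩, ?_⟩
    funext l; fin_cases l <;> rfl
  calc (S.filter (fun x => dist z (meshPoint δ x) ≤ 6 * δ)).card
      ≤ (((Finset.Icc (a - 6) (a + 6)) ×ˢ (Finset.Icc (b - 6) (b + 6))).image (fun p => ![p.1, p.2])).card :=
        Finset.card_le_card hsub
    _ ≤ ((Finset.Icc (a - 6) (a + 6)) ×ˢ (Finset.Icc (b - 6) (b + 6))).card := Finset.card_image_le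
    _ = 169 := by
        rw [Finset.card_product, Int.card_Icc, Int.card_Icc]
        have : (a + 6 + 1 - (a - 6)).toNat = 13 := by omega
        have : (b + 6 + 1 - (b - 6)).toNat = 13 := by omega
        simp_all

/-- **Area of the block metric.** The Borel metric `ĝ(z) = Σ_x w(x) 𝟙[dist(z, δx) ≤ 6δ]`, `x` over the
lattice vertices of `Ω̄`, `w(x) = Σ_{e ∋ x} W(e)`, has `∬ ĝ² ≤ 4·10⁵ δ² Σ_e W(e)²` (bounded overlap:
`≤ 169` balls through a point, `≤ 8` edges at a vertex, `≤ 2` lattice vertices on an edge). [folklore] -/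
theorem wer_lintegral_sq_le {E : Finset (Sym2 (Site 2))} (hEz : ∀ e ∈ E, e ∈ (zdGraph 2).edgeSet)
    {F : Finset (Sym2 (Site 2 ⊕ Site 2 × Fin 4))} (hF : ∀ e ∈ F, e ∈ (DiscreteRect.extGraph E).edgeSet)
    (W : Sym2 (Site 2 ⊕ Site 2 × Fin 4) → ℝ≥0) {δ : ℝ} (hδ : 0 < δ) :
    ∫⁻ z, (∑ x ∈ DiscreteRect.verts E, (closedBall (meshPoint δ x) (6 * δ)).indicator
        (fun _ => ((∑ e ∈ F with Sum.inl x ∈ e, W e : ℝ≥0) : ℝ≥0∞)) z) ^ 2 ≤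
      400000 * ENNReal.ofReal (δ ^ 2) * ∑ e ∈ F, (W e : ℝ≥0∞) ^ 2 := by
  set V := DiscreteRect.verts E with hV
  set w : Site 2 → ℝ≥0 := fun x => ∑ e ∈ F with Sum.inl x ∈ e, W e with hw
  -- pointwise bound by bounded overlap
  have hpt : ∀ z : ℂ, (∑ x ∈ V, (closedBall (meshPoint δ x) (6 * δ)).indicator (fun _ => (w x : ℝ≥0∞)) z) ^ 2 ≤
      169 * ∑ x ∈ V, (closedBall (meshPoint δ x) (6 * δ)).indicator (fun _ => ((w x : ℝ≥0∞)) ^ 2) z := by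
    intro z
    set S := V.filter (fun x => dist z (meshPoint δ x) ≤ 6 * δ) with hS
    have h1 : ∑ x ∈ V, (closedBall (meshPoint δ x) (6 * δ)).indicator (fun _ => (w x : ℝ≥0∞)) z =
        ∑ x ∈ S, (w x : ℝ≥0∞) := by
      rw [hS, Finset.sum_filter]
      refine Finset.sum_congr rfl fun x _ => ?_
      simp only [Set.indicator_apply, Metric.mem_closedBall]
    have h2 : ∑ x ∈ V, (closedBall (meshPoint δ x) (6 * δ)).indicator (fun _ => ((w x : ℝ≥0∞)) ^ 2) z =
        ∑ x ∈ S, (w x : ℝ≥0∞) ^ 2 := by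
      rw [hS, Finset.sum_filter]
      refine Finset.sum_congr rfl fun x _ => ?_
      simp only [Set.indicator_apply, Metric.mem_closedBall]
    rw [h1, h2]
    have hcs : (∑ x ∈ S, w x) ^ 2 ≤ S.card * ∑ x ∈ S, w x ^ 2 := sq_sum_le_card_mul_sum_sq
    have hcard : (S.card : ℝ≥0) ≤ 169 := by exact_mod_cast wer_card_near hδ z V
    have h3 : (∑ x ∈ S, w x) ^ 2 ≤ 169 * ∑ x ∈ S, w x ^ 2 :=
      hcs.trans (mul_le_mul_of_nonneg_right hcard (Finset.sum_nonneg fun _ _ => sq_nonneg _))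
    have h4 : ((∑ x ∈ S, w x) ^ 2 : ℝ≥0∞) ≤ ((169 * ∑ x ∈ S, w x ^ 2 : ℝ≥0) : ℝ≥0∞) := by
      exact_mod_cast h3
    refine le_trans (by push_cast; exact le_rfl) (h4.trans (by push_cast; exact le_rfl))
  -- integrate
  have hmeas : ∀ x ∈ V, Measurable fun z : ℂ =>
      (closedBall (meshPoint δ x) (6 * δ)).indicator (fun _ => ((w x : ℝ≥0∞)) ^ 2) z :=
    fun x _ => measurable_const.indicator measurableSet_closedBall
  have hvol : ∀ x : Site 2, volume (closedBall (meshPoint δ x) (6 * δ)) = ENNReal.ofReal (6 * δ) ^ 2 * NNReal.pi :=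
    fun x => Complex.volume_closedBall _ _
  have hpi : ((NNReal.pi : ℝ≥0) : ℝ≥0∞) ≤ 4 := by
    have : (NNReal.pi : ℝ≥0) ≤ 4 := by
      rw [← NNReal.coe_le_coe, NNReal.coe_real_pi]; exact Real.pi_le_four
    exact_mod_cast this
  -- `w(x)² ≤ 8 Σ_{e ∋ x} W(e)²`
  have hwx : ∀ x : Site 2, (w x : ℝ≥0∞) ^ 2 ≤ 8 * ∑ e ∈ F with Sum.inl x ∈ e, (W e : ℝ≥0∞) ^ 2 := by
    intro x
    have hcs : (∑ e ∈ F with Sum.inl x ∈ e, W e) ^ 2 ≤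
        (F.filter (fun e => Sum.inl x ∈ e)).card * ∑ e ∈ F with Sum.inl x ∈ e, W e ^ 2 :=
      sq_sum_le_card_mul_sum_sq
    have hcard : ((F.filter (fun e => Sum.inl x ∈ e)).card : ℝ≥0) ≤ 8 := by
      exact_mod_cast wer_card_edges_at hEz x hF
    have h3 : w x ^ 2 ≤ 8 * ∑ e ∈ F with Sum.inl x ∈ e, W e ^ 2 :=
      hcs.trans (mul_le_mul_of_nonneg_right hcard (Finset.sum_nonneg fun _ _ => sq_nonneg _))
    have h4 : ((w x ^ 2 : ℝ≥0) : ℝ≥0∞) ≤ ((8 * ∑ e ∈ F with Sum.inl x ∈ e, W e ^ 2 : ℝ≥0) : ℝ≥0∞) := by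
      exact_mod_cast h3
    refine le_trans (by push_cast; exact le_rfl) (h4.trans (by push_cast; exact le_rfl))
  -- `Σ_x Σ_{e ∋ x} W(e)² ≤ 2 Σ_e W(e)²`
  have hswap : ∑ x ∈ V, ∑ e ∈ F with Sum.inl x ∈ e, (W e : ℝ≥0∞) ^ 2 ≤ 2 * ∑ e ∈ F, (W e : ℝ≥0∞) ^ 2 := by
    have h1 : ∑ x ∈ V, ∑ e ∈ F with Sum.inl x ∈ e, (W e : ℝ≥0∞) ^ 2 =
        ∑ e ∈ F, ∑ x ∈ V with Sum.inl x ∈ e, (W e : ℝ≥0∞) ^ 2 := by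
      simp only [Finset.sum_filter]
      exact Finset.sum_comm
    rw [h1, Finset.mul_sum]
    refine Finset.sum_le_sum fun e _ => ?_
    rw [Finset.sum_const, nsmul_eq_mul]
    gcongr
    exact_mod_cast wer_card_inl_mem V e
  calc ∫⁻ z, (∑ x ∈ V, (closedBall (meshPoint δ x) (6 * δ)).indicator (fun _ => (w x : ℝ≥0∞)) z) ^ 2
      ≤ ∫⁻ z, 169 * ∑ x ∈ V, (closedBall (meshPoint δ x) (6 * δ)).indicator (fun _ => ((w x : ℝ≥0∞)) ^ 2) z :=
        lintegral_mono hpt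
    _ = 169 * ∑ x ∈ V, (w x : ℝ≥0∞) ^ 2 * (ENNReal.ofReal (6 * δ) ^ 2 * NNReal.pi) := by
        rw [lintegral_const_mul _ (Finset.measurable_sum _ hmeas), lintegral_finsetSum _ hmeas]
        congr 1
        refine Finset.sum_congr rfl fun x _ => ?_
        rw [lintegral_indicator_const measurableSet_closedBall, hvol]
    _ ≤ 169 * ∑ x ∈ V, (8 * ∑ e ∈ F with Sum.inl x ∈ e, (W e : ℝ≥0∞) ^ 2) * (ENNReal.ofReal (6 * δ) ^ 2 * 4) := by
        gcongr with x hx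
        · exact hwx x
    _ = 169 * 8 * (ENNReal.ofReal (6 * δ) ^ 2 * 4) * ∑ x ∈ V, ∑ e ∈ F with Sum.inl x ∈ e, (W e : ℝ≥0∞) ^ 2 := by
        rw [← Finset.sum_mul, ← Finset.mul_sum]; ring
    _ ≤ 169 * 8 * (ENNReal.ofReal (6 * δ) ^ 2 * 4) * (2 * ∑ e ∈ F, (W e : ℝ≥0∞) ^ 2) := by gcongr
    _ = 389376 * ENNReal.ofReal (δ ^ 2) * ∑ e ∈ F, (W e : ℝ≥0∞) ^ 2 := by
        rw [ENNReal.ofReal_mul (by norm_num : (0 : ℝ) ≤ 6), mul_pow, ← ENNReal.ofReal_pow hδ.le,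
          ENNReal.ofReal_ofNat]
        ring
    _ ≤ 400000 * ENNReal.ofReal (δ ^ 2) * ∑ e ∈ F, (W e : ℝ≥0∞) ^ 2 := by gcongr; norm_num

/-- A finite partial sum of `W²` over edges is at most the area `Σ_e W(e)²` of the unit network. [folklore] -/
theorem wer_sum_sq_le_networkArea {V : Type*} (G : SimpleGraph V) (W : Sym2 V → ℝ≥0) (F : Finset (Sym2 V))
    (hF : ∀ e ∈ F, e ∈ G.edgeSet) : ∑ e ∈ F, (W e : ℝ≥0∞) ^ 2 ≤ networkArea G 1 W := by
  unfold networkArea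
  calc ∑ e ∈ F, (W e : ℝ≥0∞) ^ 2
      = ∑ e ∈ F, G.edgeSet.indicator (fun e => (((1 : Sym2 V → ℝ≥0) e : ℝ≥0) : ℝ≥0∞) * (W e : ℝ≥0∞) ^ 2) e := by
        refine Finset.sum_congr rfl fun e he => ?_
        rw [Set.indicator_of_mem (hF e he), Pi.one_apply, ENNReal.coe_one, one_mul]
    _ ≤ _ := ENNReal.sum_le_tsum F

/-- The edge set of the completed graph `Ω̄` of a finite set of lattice edges is finite (as a `Finset`).
[folklore] -/
theorem wer_exists_edgeFinset {E : Finset (Sym2 (Site 2))} (hEz : ∀ e ∈ E, e ∈ (zdGraph 2).edgeSet) :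
    ∃ F : Finset (Sym2 (Site 2 ⊕ Site 2 × Fin 4)), ∀ e, e ∈ F ↔ e ∈ (DiscreteRect.extGraph E).edgeSet := by
  set f : (Site 2 × Fin 4) × Bool → Sym2 (Site 2 ⊕ Site 2 × Fin 4) := fun d =>
    if d.2 then s(Sum.inl d.1.1, Sum.inl (d.1.1 + DiscreteRect.dir d.1.2)) else s(Sum.inl d.1.1, Sum.inr d.1) with hf
  refine ⟨(((DiscreteRect.verts E ×ˢ Finset.univ) ×ˢ Finset.univ).image f).filter
    (fun e => e ∈ (DiscreteRect.extGraph E).edgeSet), fun e => ⟨fun h => (Finset.mem_filter.1 h).2, fun h => ?_⟩⟩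
  refine Finset.mem_filter.2 ⟨?_, h⟩
  rw [Finset.mem_image]
  revert h
  induction e using Sym2.ind with
  | h a b =>
    intro h
    have hadj : (DiscreteRect.extGraph E).Adj a b := h
    have key : ∀ (x : Site 2) (c : Site 2 ⊕ Site 2 × Fin 4), (DiscreteRect.extGraph E).Adj (Sum.inl x) c →
        ∃ d ∈ (DiscreteRect.verts E ×ˢ (Finset.univ : Finset (Fin 4))) ×ˢ (Finset.univ : Finset Bool),
          f d = s(Sum.inl x, c) := by
      intro x c hxc
      cases c with
      | inl y =>
        obtain ⟨-, hxy⟩ := DiscreteRect.extGraph_adj_inl_inl.1 hxc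
        have hx : x ∈ DiscreteRect.verts E := by
          rw [Sym2.eq_swap] at hxy; exact DiscreteRect.mem_verts_of_mem hxy
        have hzd : (zdGraph 2).Adj x y := (SimpleGraph.mem_edgeSet _).1 (hEz _ hxy)
        obtain ⟨k, rfl⟩ := exists_dir_of_zdGraph_adj_rim hzd
        exact ⟨((x, k), true), by simp [hx], by simp [hf]⟩
      | inr d =>
        obtain ⟨hd, hd1⟩ := DiscreteRect.extGraph_adj_inl_inr.1 hxc
        obtain ⟨d1, d2⟩ := d
        simp only at hd1
        subst hd1
        exact ⟨((d1, d2), false), by simp [hd.1], by simp [hf]⟩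
    cases a with
    | inl x => exact key x b hadj
    | inr d =>
      cases b with
      | inl x =>
        obtain ⟨d', hd', hfd'⟩ := key x (Sum.inr d) hadj.symm
        exact ⟨d', hd', by rw [hfd', Sym2.eq_swap]⟩
      | inr d' => exact absurd hadj DiscreteRect.extGraph_not_adj_inr_inr

/-- `wer_exists_edgeFinset`, closed form (registered sub-goal of stmt-CriticalPhenomena-10650). [folklore] -/
theorem wer_exists_edgeFinset' : ∀ {E : Finset (Sym2 (Site 2))}, (∀ e ∈ E, e ∈ (zdGraph 2).edgeSet) → ∃ F : Finset (Sym2 (Site 2 ⊕ Site 2 × Fin 4)), ∀ e, e ∈ F ↔ e ∈ (DiscreteRect.extGraph E).edgeSet :=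
  fun hEz => wer_exists_edgeFinset hEz

end Summit.CriticalPhenomena.SAWScalingLimit.Theorems.IsingBoundaryRatio

end
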